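import Summits.BirchSwinnertonDyer.BirchSwinnertonDyer.Theorems.KatoDescentTamePotSupersingularTameUpperOpenRowCertificates
import Literature.NumberTheory.EllipticCurves.FineSelmerRankEqualityNonsplitCartanFiveInertia
import HarnessLib

/-!
# Route `KatoDescentTamePotSupersingular` (rung K8, sub-rung B4 (t′), cell `bsd-potss`): U₀ at a `5Nn` row FROM THE RANK EQUALITY ALONE
# — the inertia input `σ̄_x¹² ∈ I(𝔮|5)` is now KERNEL — and the row `396900b1` @ 5

Seat `bsd-potss-k8t-c4` g26; `--supports stmt-BirchSwinnertonDyer-19982 --as helper`. THEOREMS ONLY (no definition, no named fact, no `sorry`);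
nothing booked; (A), Conjecture A and BSD are proved for NO curve here; items 19202 / 19982 stay OPEN at class level (open inputs class-wide: zeta
crux 24439, lower half of 19984).

k8t-c4 g25 (`TameRankEqRecords.missingUpperBoundAt_five_tame_of_nonsplitCartanBasis_of_rankEq`, file `…TameUpperRankEqConjARecord396900b1`)
derived U₀ `MissingUpperBoundAt E 5` at a rank-`0` (t′) row with mod-`5` image `C_ns⁺(5)` from `hKatoA hGZK hmod`, the basis data, the LAYER-0
rank equality `#Cl(ℚ(P))[5] = #Cl(ℚ(x(P)))[5]` (`hrank`) AND the inertia condition `hcI : σ̄_x¹² ∈ I(𝔮)` for every prime `𝔮 ∋ 5` of `ℚ(E[5])`.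
The Literature theorem `CoatesSujatha2005.RankEqualityRoad.pow_twelve_mem_inertia_of_nonsplitCartanNormalizer` (k8t-c4 g26: `det ρ̄_{E,5}(I(𝔮|5)) = 𝔽₅ˣ`
by the Weil pairing and the total ramification of `5` in `ℚ(ζ₅)`, plus the finite fact «`M ∈ C_ns⁺(ε)`, `det M = 2` ⇒ `M¹² = −1`») makes `hcI`
AUTOMATIC, so:

§1 `missingUpperBoundAt_five_tame_of_nonsplitCartanBasis_of_rankEq'` — U₀ at any rank-`0` (t′) `5Nn` row modulo `hKatoA hGZK hmod` from the basis
data and the ONE class-group datum `hrank`;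
§2 `missingUpperBoundAt_g396900b1_5_of_rankEq'` — the row `396900b1` @ 5: displayed = `hKatoA hGZK hmod` + Cremona's `r_an = 0` + basis data +
`hrank` (numerically `5 = 5`: `h(ℚ(x(P))) = 30` certified, `h(ℚ(P)) = 60` under GRH; kit j332102 / j333234).  KERNEL: `E[5]` irreducible, `Addv`,
`SubTprime`, `5 ∤ #Gal(ℚ(E[5])/ℚ)`, `σ̄_x¹²` central AND in every `I(𝔮|5)`.

References: [Kato2004Asterisque] Thm. 14.5 (3); [CoatesSujatha2005] Thm. 3.4; [Iwasawa1956]; [Serre1972] §2.2, §5.2 (iii); [Cremona2006] Table 1.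
-/

set_option autoImplicit false
-- the Theorems directory repeats the summit name (`Summits/BirchSwinnertonDyer/BirchSwinnertonDyer/…`): house rule of the cell
set_option linter.dupNamespace false

noncomputable section

open scoped Classical NumberField Matrix
open WeierstrassCurve Field IntermediateField
  Literature.NumberTheory.EllipticCurves Literature.NumberTheory.EllipticCurves.Rank1Residual
  Literature.NumberTheory.EllipticCurves.Rank1Residual.Typed
  Literature.NumberTheory.GaloisRepresentations Literature.NumberTheory.SerreUniformity
  Literature.NumberTheory.IwasawaTheory
  Literature.NumberTheory.EllipticCurves.CoatesSujatha2005.RankEqualityRoad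
  Summit.BirchSwinnertonDyer.Rank1Residual Summit.BirchSwinnertonDyer.Rank1Residual.Additive
  Summit.BirchSwinnertonDyer.BirchSwinnertonDyer.Theorems

namespace Summit.BirchSwinnertonDyer.BirchSwinnertonDyer.Theorems.TameRankEqRecords

/-! ### §1 U₀ at a rank-`0` (t′) `5Nn` row from the rank equality alone (modulo `hKatoA hGZK hmod`) -/

/-- **U₀ `MissingUpperBoundAt E 5` at a rank-`0` (t′) row with image in `C_ns⁺(5)` FROM THE RANK EQUALITY ALONE** — the named facts
`hKatoA hGZK hmod`, Cremona's `r_an = 0`, `Addv E 5`, `SubTprime E 5`, `E[5]` irreducible, the basis data and the ONE class-group datum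
`#Cl(ℚ(P))[5] = #Cl(ℚ(x(P)))[5]`; NO `μ`-hypothesis, NO inertia hypothesis (compare g25's `…_of_rankEq`, which displays `hcI`, and
`CartanMuRoadDoorsTprimeFive.…_of_nonsplitCartanBasis_of_mu`, which displays seven classical-`μ` hypotheses).
`CoatesSujatha2005.RankEqualityRoad.conjA_five_of_nonsplitCartanBasis_of_rankEq'` ∘ `CartanMuRoadDoorsTprimeFive.missingUpperBoundAt_tame_of_conjA`.
CONDITIONAL; nothing booked; BSD for no curve. [cite: Kato2004Asterisque, Thm. 14.5 (3) (p. 236)] [cite: CoatesSujatha2005, §3 Thm. 3.4]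
[cite: Iwasawa1956, §§3–5] [cite: Serre1972, §2.2 and §5.2 (iii)] -/
theorem missingUpperBoundAt_five_tame_of_nonsplitCartanBasis_of_rankEq' (W : WeierstrassCurve ℚ) [W.IsElliptic] [W.IsGloballyMinimal]
    (hKatoA : Kato2004.rankZero_padicValNat_sha_add_padicValNat_tamagawa_le_of_additive_potGood_of_irreducible_of_fineSelmerDual_fg)
    (hGZK : rank_eq_analyticRank_of_analyticRank_le_one) (hmod : hasEntireLFunction_rat)
    (hr : W.analyticRank = 0) (hadd : haveI : Fact (Nat.Prime 5) := ⟨by norm_num⟩; Addv W 5)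
    (hT : haveI : Fact (Nat.Prime 5) := ⟨by norm_num⟩; SubTprime W 5)
    (hirr : haveI : Fact (Nat.Prime 5) := ⟨by norm_num⟩; W.HasIrreducibleModPGaloisRep 5)
    (e : W.geomTorsion (5 : ℕ) ≃+ (Fin 2 → ZMod 5)) {ε : ZMod 5} (hε : ¬ IsSquare ε)
    (he : ∀ σ : absoluteGaloisGroup ℚ, ∃ M ∈ nonsplitCartanNormalizer ε, ∀ P : W.geomTorsion (5 : ℕ), e (σ • P) = M *ᵥ e P)
    (σx σs : absoluteGaloisGroup ℚ) (hσx : ∀ P : W.geomTorsion (5 : ℕ), e (σx • P) = !![1, ε * (4 - ε); 4 - ε, 1] *ᵥ e P)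
    (hσs : ∀ P : W.geomTorsion (5 : ℕ), e (σs • P) = !![1, 0; 0, 4] *ᵥ e P)
    (hrank : Nat.card {d : ClassGroup (𝓞 ↥(fixedField (Subgroup.zpowers (absRestrictNormalHom (W.divisionField 5) σs)))) // d ^ 5 = 1} =
      Nat.card {d : ClassGroup (𝓞 ↥(fixedField (Subgroup.zpowers (absRestrictNormalHom (W.divisionField 5) σx ^ 12) ⊔
        Subgroup.zpowers (absRestrictNormalHom (W.divisionField 5) σs)))) // d ^ 5 = 1}) :
    haveI : Fact (Nat.Prime 5) := ⟨by norm_num⟩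
    MissingUpperBoundAt W 5 := by
  haveI : Fact (Nat.Prime 5) := ⟨by norm_num⟩
  exact CartanMuRoadDoorsTprimeFive.missingUpperBoundAt_tame_of_conjA W hKatoA hGZK hmod 5 hr (by decide) hadd hT hirr
    (conjA_five_of_nonsplitCartanBasis_of_rankEq' W e hε he σx σs hσx hσs hrank)

/-! ### §2 The row `396900b1` @ 5 -/

/-- **CONDITIONAL U₀ for `396900b1` @ 5 FROM THE RANK EQUALITY ALONE.**  `ord₅ #Ш(E) ≤ ord₅ #Ш_an(E)` (`MissingUpperBoundAt E 5`) for
`E = 396900b1 = [0, 0, 0, −73959375, 244814963750]` (`N = 2²·3⁴·5²·7²`, Kodaira IV* at 5, (t′), mod-5 image `C_ns⁺(5)`), from: the named facts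
`hKatoA hGZK hmod`; Cremona's `r_an = 0` (`hr`); the `C_ns⁺(ε)` basis data (`e hε he σx σs hσx hσs`); the rank equality `#Cl(ℚ(P))[5] = #Cl(ℚ(x(P)))[5]`
(`hrank`; numerically `5 = 5`: `h(ℚ(x(P))) = 30` certified, `h(ℚ(P)) = 60` under GRH; kit j332102).  No `μ`-hypothesis, no inertia hypothesis
(g25's `hcI` is now the kernel theorem `pow_twelve_mem_inertia_of_nonsplitCartanNormalizer`).  KERNEL: `E[5]` irreducible, `Addv`, `SubTprime`
(tree, `TameConjAFiveRecords`).  Per row; CONDITIONAL; nothing booked; BSD is not proved by this. [cite: Kato2004Asterisque, Thm. 14.5 (3) (p. 236)]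
[cite: CoatesSujatha2005, §3 Thm. 3.4] [cite: Iwasawa1956, §§3–5] [cite: Cremona2006, Table 1 (Cremona label 396900b1)] -/
theorem missingUpperBoundAt_g396900b1_5_of_rankEq'
    (hKatoA : Kato2004.rankZero_padicValNat_sha_add_padicValNat_tamagawa_le_of_additive_potGood_of_irreducible_of_fineSelmerDual_fg)
    (hGZK : rank_eq_analyticRank_of_analyticRank_le_one) (hmod : hasEntireLFunction_rat)
    {W : WeierstrassCurve ℚ} [W.IsElliptic] [W.IsGloballyMinimal] (hWeq : W = (⟨0, 0, 0, (-73959375), 244814963750⟩ : WeierstrassCurve ℚ))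
    (hr : W.analyticRank = 0)
    (e : W.geomTorsion (5 : ℕ) ≃+ (Fin 2 → ZMod 5)) {ε : ZMod 5} (hε : ¬ IsSquare ε)
    (he : ∀ σ : absoluteGaloisGroup ℚ, ∃ M ∈ nonsplitCartanNormalizer ε, ∀ P : W.geomTorsion (5 : ℕ), e (σ • P) = M *ᵥ e P)
    (σx σs : absoluteGaloisGroup ℚ) (hσx : ∀ P : W.geomTorsion (5 : ℕ), e (σx • P) = !![1, ε * (4 - ε); 4 - ε, 1] *ᵥ e P)
    (hσs : ∀ P : W.geomTorsion (5 : ℕ), e (σs • P) = !![1, 0; 0, 4] *ᵥ e P)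
    (hrank : Nat.card {d : ClassGroup (𝓞 ↥(fixedField (Subgroup.zpowers (absRestrictNormalHom (W.divisionField 5) σs)))) // d ^ 5 = 1} =
      Nat.card {d : ClassGroup (𝓞 ↥(fixedField (Subgroup.zpowers (absRestrictNormalHom (W.divisionField 5) σx ^ 12) ⊔
        Subgroup.zpowers (absRestrictNormalHom (W.divisionField 5) σs)))) // d ^ 5 = 1}) :
    MissingUpperBoundAt W 5 := by
  subst hWeq
  exact missingUpperBoundAt_five_tame_of_nonsplitCartanBasis_of_rankEq' _ hKatoA hGZK hmod hr
    TameConjAFiveRecords.addv_g396900b1_5 TameConjAFiveRecords.subTprime_g396900b1_5 TameConjAFiveRecords.irr_g396900b1_5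
    e hε he σx σs hσx hσs hrank

end Summit.BirchSwinnertonDyer.BirchSwinnertonDyer.Theorems.TameRankEqRecords

end
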